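import Summits.ResolutionOfSingularities.ResolutionOfSingularities.Theorems.WeightedInvariantLocalWeightedDropNCResPhaseAssembly
import Summits.ResolutionOfSingularities.ResolutionOfSingularities.Theorems.WeightedInvariantLocalWeightedDropNCEndgameOrderOne

/-!
# TOT2-LINE, piece S-ASM (outer half) with the endgame DISCHARGED: the `o ≤ 1` half binder-free at `m = 2` (R8 instantiated)

Crux item stmt-ResolutionOfSingularities-8899 `WeightedInvariant.LocalWeightedDrop` (route `ResolutionOfSingularities/WeightedInvariant`), ENGINE
skeleton v32 (ddb48572591139d5), registered residual `stub_spaceNCRankDrop`; TOT2-LINE v1/v1.1 (res-L1-w43-lead-1).  [OURS · L1 W4.3 · seat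
res-D-pv-006 (S-END hand); def-free; NOT a statement of any manuscript; AI-produced, gate-checked, weaker than expert review.]

res-L1-w43-stub-1's outer assembly `…NCResPhaseAssembly` (p534993) takes the `o ≤ 1` endgame from the bare rung `hR8`; the rung is now the
tree constant `NCTransport.exists_winsIn_orderOne_mul_prod` (R8, `…NCEndgameOrderOne`, strategist text res-L1-w43-strat-1), valid over EVERY
field.  This file records the binder-free forms at `m = 2`:
* `endPhase`, `endPhase'` — every admissibly decorated position `(b, δ)` in three variables with `δ.o ≤ 1` wins towards «the germ is a normal
  crossing» (resp. the head-phase disjunction) on the PRODUCT state type read through `Prod.fst`;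
* `ncRankDrop_of_highPhase` — the positional ordinal rank drop from the `o ≥ 2` phase ALONE;
* **`spaceNCRankDrop_of_highPhase`** — THE REGISTERED STUB'S TEXT (`stub_spaceNCRankDrop`, `m + 1 = 3`, binders `∀ p prime, ∀ k, [Field k]
  [CharP k p] [IsAlgClosed k]`) from the `o ≥ 2` phase alone: what remains of `stub_spaceNCRankDrop` is exactly `hhigh` (res-L1-w43-lead-1's
  inner composition S-STRAT / S-E0 / S-E1 / S-E2′ / S-CRV, fed to `highPhase_of_step`).
-/

set_option linter.dupNamespace false -- mandated namespace of this single-conjunct summit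

namespace Summit.ResolutionOfSingularities.ResolutionOfSingularities.Theorems

namespace TameFourTupleDrop

open MvPowerSeries Literature.AlgebraicGeometry.Resolution

variable {k : Type} [Field k]

/-- **THE ENDGAME ON PRODUCT STATES, binder-free (three variables, every field)**: every admissibly decorated position with `o ≤ 1` wins
towards «the germ is a normal crossing». -/
theorem endPhase (b : MvPowerSeries (Fin (2 + 1)) k) (δ : Decoration k 2) (hadm : Admissible b δ) (ho : δ.o ≤ 1) :
    DWinsTo (St := MvPowerSeries (Fin (2 + 1)) k × Decoration k 2) Prod.fst (fun τ => GermIsNC τ.1) (b, δ) :=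
  endPhase_of_rung (fun f hf E => NCTransport.exists_winsIn_orderOne_mul_prod f hf E) b δ hadm ho

/-- The endgame half of the head phase, binder-free (target widened to the head-phase disjunction). -/
theorem endPhase' (b : MvPowerSeries (Fin (2 + 1)) k) (δ : Decoration k 2) (hadm : Admissible b δ) (ho : δ.o ≤ 1) :
    DWinsTo (St := MvPowerSeries (Fin (2 + 1)) k × Decoration k 2) Prod.fst
      (fun τ => GermIsNC τ.1 ∨ (Admissible τ.1 τ.2 ∧ τ.2.head < δ.head)) (b, δ) :=
  endPhase_of_rung' (fun f hf E => NCTransport.exists_winsIn_orderOne_mul_prod f hf E) b δ hadm ho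

/-- **POSITIONAL RANK FROM THE `o ≥ 2` PHASE ALONE** (three variables, every field; the endgame is R8). -/
theorem ncRankDrop_of_highPhase
    (hhigh : ∀ (b : MvPowerSeries (Fin (2 + 1)) k) (δ : Decoration k 2), Admissible b δ → 2 ≤ δ.o →
      DWinsTo (St := MvPowerSeries (Fin (2 + 1)) k × Decoration k 2) Prod.fst
        (fun τ => Admissible τ.1 τ.2 ∧ τ.2.head < δ.head) (b, δ)) :
    ∃ ρ : MvPowerSeries (Fin (2 + 1)) k → Ordinal.{0}, ∀ b : MvPowerSeries (Fin (2 + 1)) k, b ≠ 0 → ¬ GermIsNC b →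
      ∃ (Φ : Fin (2 + 1) → MvPowerSeries (Fin (2 + 1)) k) (w : Fin (2 + 1) → ℕ),
        IsCountMove Φ w ∧ MoveClause b Φ w (fun b' => ρ b' < ρ b) :=
  ncRankDrop_of_highPhase_of_rung (fun f hf E => NCTransport.exists_winsIn_orderOne_mul_prod f hf E) hhigh

/-- **THE REGISTERED STUB'S TEXT (`stub_spaceNCRankDrop`, skeleton v32, `m + 1 = 3`) FROM THE `o ≥ 2` PHASE ALONE** — the endgame `hR8` of
`spaceNCRankDrop_of_highPhase_of_rung` is discharged by R8 uniformly in `p` and `k` (R8 holds over every field). -/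
theorem spaceNCRankDrop_of_highPhase
    (hhigh : ∀ (p : ℕ), p.Prime → ∀ (k : Type) [Field k] [CharP k p] [IsAlgClosed k],
      ∀ (b : MvPowerSeries (Fin 3) k) (δ : Decoration k 2), Admissible b δ → 2 ≤ δ.o →
        DWinsTo (St := MvPowerSeries (Fin 3) k × Decoration k 2) Prod.fst
          (fun τ => Admissible τ.1 τ.2 ∧ τ.2.head < δ.head) (b, δ)) :
    ∀ (p : ℕ), p.Prime → ∀ (k : Type) [Field k] [CharP k p] [IsAlgClosed k],
      ∃ ρ : MvPowerSeries (Fin 3) k → Ordinal.{0}, ∀ b : MvPowerSeries (Fin 3) k, b ≠ 0 → ¬ GermIsNC b →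
        ∃ (Φ : Fin 3 → MvPowerSeries (Fin 3) k) (w : Fin 3 → ℕ),
          IsCountMove (m := 2) Φ w ∧ MoveClause (m := 2) b Φ w (fun b' => ρ b' < ρ b) :=
  spaceNCRankDrop_of_highPhase_of_rung (fun _ _ _ _ _ _ f hf E => NCTransport.exists_winsIn_orderOne_mul_prod f hf E) hhigh

end TameFourTupleDrop

end Summit.ResolutionOfSingularities.ResolutionOfSingularities.Theorems
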